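import Mathlib
import HarnessLib
import Literature.NumberTheory.DiophantineGeometry.RothPrelim
import Literature.NumberTheory.DiophantineGeometry.RothTaylor
import Literature.NumberTheory.DiophantineGeometry.RothLemmaOne
import Literature.NumberTheory.DiophantineGeometry.RothLemmaHeights

/-!
# Roth's theorem after Schmidt (LNM 785, Ch. V) — Roth's Lemma 10A: integer slices of the Wronskian and its height

Source: W. M. Schmidt, *Diophantine Approximation*, LNM 785 (1980), Ch. V §10, proof of Lemma 10B
(book pp. 131–132) [Schmidt1980].

Schmidt factors the integer Wronskian as `W = V* U*` with integer `V*(X')`, `U*(X_m)` ("clearly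
there is a factorization …", Gauss' Lemma) and bounds `|U*|, |V*| ≤ |W| ≤ q₁^{2ωγ r₁ k}` (10.10).
Here the factorisation is replaced by the following equivalent device, which avoids contents:
whenever the coefficients of `W ∈ ℤ[X₀,…,X_{n+1}]` have the product structure
`W_j = c'(j') c''(j_m)` (which `W = V(X') U(X_m)` over `ℚ` provides), the two *slices*
`V' = Σ_{j_m = ν₀} W_j X'^{j'}` and `u' = Σ_{j' = κ₀} W_j X^{j_m}` through a non-zero coefficient
`W_{j₀}`, `j₀ = (κ₀, ν₀)`, are non-zero integer polynomials with `W_{j₀} · W = V' · u'(X_m)`,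
`|V'|, |u'| ≤ |W|` and degrees bounded by those of `W` (`Roth.exists_intSlices`). Since `V'`, `u'`
are constant multiples of `V`, `U` over `ℚ`, they have the same indices, and the scalar `W_{j₀}` is
harmless (`Roth.rothLemma_of_wronskianData'`).

The height estimate (10.10) in the form `|W| ≤ k! (Π_h (r_h+1) · 2^{Σ r_h} |P|)^k` for
`W = det (P_{μ_i, j})` with `deg_{X_h} P ≤ r_h` (`Roth.height_wronskianDet_le`), and
`deg_{X_h} W ≤ k r_h` (`Roth.degreeOf_wronskianDet_le`).

## References

* [Schmidt1980] W. M. Schmidt, *Diophantine Approximation*, LNM 785, Springer 1980, Ch. V,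
  proof of Lemma 10B, (10.10), pp. 131–132.
-/

noncomputable section

open MvPolynomial Finset

namespace Literature.NumberTheory.DiophantineGeometry

namespace Roth

variable {n : ℕ}

/-! ### Integer slices of a polynomial with rank-one coefficients -/

/-- Removing the `t₀`-component of `κ + ν e_{t₀}` gives back `κ` when `κ_{t₀} = 0`. [folklore] -/
theorem erase_add_single_of_zero {σ : Type*} [DecidableEq σ] {t₀ : σ} {κ : σ →₀ ℕ} (hκ : κ t₀ = 0)
    (ν : ℕ) : Finsupp.erase t₀ (κ + Finsupp.single t₀ ν) = κ := by
  ext h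
  rcases eq_or_ne h t₀ with rfl | hh
  · rw [Finsupp.erase_same, hκ]
  · rw [Finsupp.erase_ne hh, Finsupp.add_apply, Finsupp.single_apply, if_neg (Ne.symm hh), add_zero]

/-- **Integer slices** (replacing Schmidt's `W = V* U*`): if `0 ≠ W ∈ ℤ[X₀,…,X_{n+1}]` has
coefficients of the form `W_j = c'(j') c''(j_m)` (`j'` = `j` without its `X_m`-component), then
there are non-zero integer polynomials `V'` (free of `X_m`) and `u'` (in `X_m`) and a non-zero
integer `c` (a coefficient of `W`) with `c W = V' · u'(X_m)`, `|V'|, |u'(X_m)| ≤ |W|`,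
`deg_{X_h} V' ≤ deg_{X_h} W`. [cite: Schmidt1980, Ch. V proof of Lemma 10B ("clearly there is a
factorization W = V* U*", (10.10))] -/
theorem exists_intSlices (W : MvPolynomial (Fin (n + 2)) ℤ) (hW : W ≠ 0)
    (cV : (Fin (n + 2) →₀ ℕ) → ℚ) (cU : ℕ → ℚ)
    (hcoef : ∀ j, ((coeff j W : ℤ) : ℚ) =
      cV (Finsupp.erase (Fin.last (n + 1)) j) * cU (j (Fin.last (n + 1)))) :
    ∃ (V' : MvPolynomial (Fin (n + 2)) ℤ) (u' : Polynomial ℤ) (c : ℤ),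
      c ≠ 0 ∧ V' ≠ 0 ∧ u' ≠ 0 ∧ V'.degreeOf (Fin.last (n + 1)) = 0 ∧
      (∀ h, V'.degreeOf h ≤ W.degreeOf h) ∧ height V' ≤ height W ∧
      height (toMv (Fin.last (n + 1)) u') ≤ height W ∧
      C c * W = V' * toMv (Fin.last (n + 1)) u' := by
  classical
  set L := Fin.last (n + 1) with hL
  obtain ⟨j₀, hj₀⟩ := support_nonempty.mpr hW
  have hc0 : coeff j₀ W ≠ 0 := mem_support_iff.mp hj₀
  set ν₀ : ℕ := j₀ L with hν₀
  set κ₀ : Fin (n + 2) →₀ ℕ := Finsupp.erase L j₀ with hκ₀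
  have hκ₀L : κ₀ L = 0 := by simp [hκ₀]
  have hj₀eq : κ₀ + Finsupp.single L ν₀ = j₀ := erase_add_single L j₀
  set SV := W.support.filter (fun j => j L = ν₀) with hSV
  set SU := W.support.filter (fun j => Finsupp.erase L j = κ₀) with hSU
  set V' : MvPolynomial (Fin (n + 2)) ℤ := ∑ j ∈ SV, monomial (Finsupp.erase L j) (coeff j W)
    with hV'
  set u' : Polynomial ℤ := ∑ j ∈ SU, Polynomial.monomial (j L) (coeff j W) with hu'
  -- coefficients of the slices
  have hcoeffV' : ∀ κ : Fin (n + 2) →₀ ℕ,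
      coeff κ V' = if κ L = 0 then coeff (κ + Finsupp.single L ν₀) W else 0 := by
    intro κ
    rw [hV', coeff_sum]
    simp only [coeff_monomial]
    split_ifs with hκ
    · rw [Finset.sum_eq_single (κ + Finsupp.single L ν₀)]
      · rw [if_pos (erase_add_single_of_zero hκ ν₀)]
      · intro j hj hne
        rw [if_neg]
        intro heq
        apply hne
        rw [hSV, Finset.mem_filter] at hj
        rw [← erase_add_single L j, heq, hj.2]
      · intro hnot
        rw [if_pos (erase_add_single_of_zero hκ ν₀)]
        rw [hSV, Finset.mem_filter, not_and_or] at hnot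
        rcases hnot with h | h
        · exact notMem_support_iff.mp h
        · exfalso; apply h; simp [hκ]
    · apply Finset.sum_eq_zero
      intro j _
      rw [if_neg]
      intro heq
      apply hκ
      rw [← heq, Finsupp.erase_same]
  have hcoeffu' : ∀ ν : ℕ, u'.coeff ν = coeff (κ₀ + Finsupp.single L ν) W := by
    intro ν
    rw [hu', Polynomial.finsetSum_coeff]
    simp only [Polynomial.coeff_monomial]
    rw [Finset.sum_eq_single (κ₀ + Finsupp.single L ν)]
    · rw [if_pos (by simp [hκ₀L])]
    · intro j hj hne
      rw [if_neg]
      intro heq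
      apply hne
      rw [hSU, Finset.mem_filter] at hj
      rw [← erase_add_single L j, heq, hj.2]
    · intro hnot
      rw [if_pos (by simp [hκ₀L])]
      rw [hSU, Finset.mem_filter, not_and_or] at hnot
      rcases hnot with h | h
      · exact notMem_support_iff.mp h
      · exfalso; exact h (erase_add_single_of_zero hκ₀L ν)
  -- supports / degrees of `V'`
  have hsuppV' : ∀ d ∈ V'.support, ∃ j ∈ W.support, d = Finsupp.erase L j := by
    intro d hd
    rw [hV'] at hd
    obtain ⟨j, hj, hd'⟩ := Finset.mem_biUnion.mp (support_sum hd)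
    refine ⟨j, (Finset.mem_filter.mp hj).1, ?_⟩
    have := support_monomial_subset hd'
    rwa [Finset.mem_singleton] at this
  have hV'deg : V'.degreeOf L = 0 := by
    rw [← Nat.le_zero, degreeOf_le_iff]
    intro d hd
    obtain ⟨j, -, rfl⟩ := hsuppV' d hd
    rw [Finsupp.erase_same]
  have hV'degle : ∀ h, V'.degreeOf h ≤ W.degreeOf h := by
    intro h
    rw [degreeOf_le_iff]
    intro d hd
    obtain ⟨j, hj, rfl⟩ := hsuppV' d hd
    rcases eq_or_ne h L with rfl | hh
    · rw [Finsupp.erase_same]; exact Nat.zero_le _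
    · rw [Finsupp.erase_ne hh]; exact monomial_le_degreeOf h hj
  have hu'deg : ∀ h, h ≠ L → (toMv L u').degreeOf h = 0 := fun h hh => degreeOf_toMv_of_ne L u' hh
  -- non-vanishing
  have hV'0 : V' ≠ 0 := by
    intro h0
    have := hcoeffV' κ₀
    rw [h0, coeff_zero, if_pos hκ₀L, hj₀eq] at this
    exact hc0 this.symm
  have hu'0 : u' ≠ 0 := by
    intro h0
    have := hcoeffu' ν₀
    rw [h0, Polynomial.coeff_zero, hj₀eq] at this
    exact hc0 this.symm
  -- heights
  have hhtV' : height V' ≤ height W := by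
    rw [height_le_iff]
    intro κ
    rw [hcoeffV']
    split_ifs
    · exact natAbs_coeff_le_height _ _
    · simp
  have hhtu' : height (toMv L u') ≤ height W := by
    rw [height_le_iff]
    intro j
    rw [coeff_toMv]
    split_ifs
    · rw [hcoeffu']; exact natAbs_coeff_le_height _ _
    · simp
  -- the identity `c W = V' u'(X_m)` with `c = W_{j₀}`
  refine ⟨V', u', coeff j₀ W, hc0, hV'0, hu'0, hV'deg, hV'degle, hhtV', hhtu', ?_⟩
  ext j
  rw [coeff_C_mul, coeff_mul_of_disjoint hV'deg hu'deg, hcoeffV', if_pos (Finsupp.erase_same),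
    coeff_toMv_single, hcoeffu']
  apply Int.cast_injective (α := ℚ)
  push_cast
  rw [hcoef j, hcoef (Finsupp.erase L j + Finsupp.single L ν₀), hcoef (κ₀ + Finsupp.single L (j L)),
    ← hj₀eq, hcoef (κ₀ + Finsupp.single L ν₀), erase_add_single_of_zero hκ₀L,
    erase_add_single_of_zero hκ₀L, erase_add_single_of_zero (Finsupp.erase_same)]
  simp only [Finsupp.coe_add, Pi.add_apply, Finsupp.single_eq_same, Finsupp.erase_same, hκ₀L,
    zero_add]
  ring

/-! ### Degrees and height of the generalized Wronskian -/

/-- `deg_{X_h} W ≤ k r_h` for `W = det (P_{μ_i, j})` when `deg_{X_h} P ≤ r_h`. [cite: Schmidt1980,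
Ch. V proof of Lemma 10B ("W is a polynomial with rational integer coefficients")] -/
theorem degreeOf_wronskianDet_le (P : MvPolynomial (Fin (n + 2)) ℤ) (r : Fin (n + 2) → ℕ)
    (hPdeg : ∀ h, P.degreeOf h ≤ r h) {k : ℕ} (μ : Fin k → (Fin (n + 2) →₀ ℕ)) (h : Fin (n + 2)) :
    (Matrix.of fun s j : Fin k =>
      hasseD (μ s + Finsupp.single (Fin.last (n + 1)) (j : ℕ)) P).det.degreeOf h ≤ k * r h := by
  classical
  rw [Matrix.det_apply]
  refine (degreeOf_sum_le _ _ _).trans (Finset.sup_le fun τ _ => ?_)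
  have h1 : ∀ Q : MvPolynomial (Fin (n + 2)) ℤ,
      degreeOf h (Equiv.Perm.sign τ • Q) ≤ degreeOf h Q := by
    intro Q
    rcases Int.units_eq_one_or (Equiv.Perm.sign τ) with hs | hs
    · rw [hs, one_smul]
    · rw [hs, Units.neg_smul, one_smul, ← zero_sub]
      exact (degreeOf_sub_le _ _ _).trans (by simp)
  refine (h1 _).trans ((degreeOf_prod_le _ _ _).trans ?_)
  calc ∑ i, degreeOf h ((Matrix.of fun s j : Fin k =>
          hasseD (μ s + Finsupp.single (Fin.last (n + 1)) (j : ℕ)) P) (τ i) i)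
        ≤ ∑ _i : Fin k, r h := Finset.sum_le_sum fun i _ => by
          rw [Matrix.of_apply]
          exact (degreeOf_hasseD_le' h _ P).trans (hPdeg h)
    _ = k * r h := by simp

/-- **(10.10), the count**: `|W| ≤ k! (Π_h (r_h + 1) · 2^{Σ r_h} |P|)^k` for `W = det (P_{μ_i, j})`,
`deg_{X_h} P ≤ r_h` (each entry has `≤ Π (r_h+1)` terms and height `≤ 2^{Σ r}|P|` by Lemma 5A).
[cite: Schmidt1980, Ch. V proof of Lemma 10B (10.10)] -/
theorem height_wronskianDet_le (P : MvPolynomial (Fin (n + 2)) ℤ) (r : Fin (n + 2) → ℕ)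
    (hPdeg : ∀ h, P.degreeOf h ≤ r h) {k : ℕ} (μ : Fin k → (Fin (n + 2) →₀ ℕ)) :
    height (Matrix.of fun s j : Fin k =>
      hasseD (μ s + Finsupp.single (Fin.last (n + 1)) (j : ℕ)) P).det ≤
      k.factorial * ((∏ h, (r h + 1)) * (2 ^ (∑ h, r h) * height P)) ^ k := by
  classical
  apply height_det_le
  · intro i j
    rw [Matrix.of_apply]
    exact (card_support_hasseD_le _ _).trans (card_support_le_prod_succ P r hPdeg)
  · intro i j
    rw [Matrix.of_apply]
    exact height_hasseD_le _ P r hPdeg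

end Roth

end Literature.NumberTheory.DiophantineGeometry
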